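import Summits.AtomisticToContinuum.Crystallization.Theorems.FrustratedLawDichotomyTwoShellRigidityLsLedgerLedger

/-!
# FrustratedLawDichotomy · TwoShellRigidity · the ls re-gauging LEDGER, part C (§5, section Sphere) (lens-3 g34 node d77bada9, split for the ≤ 400-line rule; critic row 662 (B)(2))

§5 — from the projected (unit-sphere) residuals to the frame residuals of the actual link (`frameRes`, …).  Same namespace as parts A–D (`…FrustratedLawDichotomyTwoShellRigidityLsLedger`); bodies byte-identical to the node; the node's full
module documentation is in part A (`…LsLedgerFrame`).
-/

noncomputable section

namespace Summit.AtomisticToContinuum.Crystallization.Theorems.FrustratedLawDichotomyTwoShellRigidityLsLedger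

open Literature.Geometry.DiscreteGeometry
open Summit.AtomisticToContinuum.Crystallization.Theorems.FrustratedLawDichotomyTwoShellRigidityCut
open Summit.AtomisticToContinuum.Crystallization.Theorems.FrustratedLawDichotomyTwoShellRigidityCells
open Summit.AtomisticToContinuum.Crystallization.Theorems.FrustratedLawDichotomyTwoShellRigidityGaugedLadder
open Summit.AtomisticToContinuum.Crystallization.Theorems.FrustratedLawDichotomyTwoShellRigidityLsEntry
open scoped RealInnerProductSpace

/-! ## §5 From the PROJECTED (unit-sphere) residuals to the frame residuals of the actual link -/

/-- The frame residual field of a dozen `x : Pat → E3` read in the frame `A`: `u ↦ A⁻¹ x_u − u`. -/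
def frameRes {Pat : Finset E3} (A : E3 ≃ₗᵢ[ℝ] E3) (x : ↥Pat → E3) (u : ↥Pat) : E3 := A.symm (x u) - u

/-- The DE-ROTATED residual field `u ↦ x_u − (lsRot x) × u` (first-order effect of re-gauging `x` into the least-squares gauge). -/
def derot (Pat : Finset E3) (x : ↥Pat → E3) (u : ↥Pat) : E3 := x u - cross (lsRot Pat x) u

/-- The total frame-residual radius `θ + (1+θ)·α` of a link with radial window `[1, 1+θ]` whose directions are `α`-close to the frame. -/
def aTot (θ α : ℝ) : ℝ := θ + (1 + θ) * α

section Sphere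

variable {Pat : Finset E3}

/-- Positive rescaling does not change the unit direction. [folklore] -/
theorem unit_smul_of_pos {c : ℝ} (hc : 0 < c) (x : E3) : ‖c • x‖⁻¹ • (c • x) = ‖x‖⁻¹ • x := by
  rw [norm_smul, Real.norm_of_nonneg hc.le, smul_smul]
  rcases eq_or_ne x 0 with hx | hx
  · simp [hx]
  · congr 1
    field_simp [norm_ne_zero_iff.2 hx, hc.ne']

/-- A brace in homogeneous form gives a cosine bound on the unit directions. [folklore] -/
theorem abs_inner_unit_le {x y : E3} {β : ℝ} (hx : x ≠ 0) (hy : y ≠ 0) (h : |⟪x, y⟫| ≤ β * (‖x‖ * ‖y‖)) :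
    |⟪‖x‖⁻¹ • x, ‖y‖⁻¹ • y⟫| ≤ β := by
  have hx' : 0 < ‖x‖ := norm_pos_iff.2 hx
  have hy' : 0 < ‖y‖ := norm_pos_iff.2 hy
  rw [real_inner_smul_left, real_inner_smul_right, ← mul_assoc, abs_mul, abs_mul, abs_inv, abs_inv, abs_norm, abs_norm]
  calc ‖x‖⁻¹ * ‖y‖⁻¹ * |⟪x, y⟫| ≤ ‖x‖⁻¹ * ‖y‖⁻¹ * (β * (‖x‖ * ‖y‖)) := by gcongr
    _ = β := by field_simp

/-- **Radial decomposition**: `A⁻¹ p_u − u = a_u + (‖p_u‖ − 1)·(u + a_u)` with `a_u = A⁻¹ e_u − u`, `e_u = p_u/‖p_u‖`. [folklore] -/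
theorem frameRes_eq_of_unit (A : E3 ≃ₗᵢ[ℝ] E3) {p e : ↥Pat → E3} (he : ∀ u, e u = ‖p u‖⁻¹ • p u)
    (hp : ∀ u, p u ≠ 0) (u : ↥Pat) :
    frameRes A p u = frameRes A e u + (‖p u‖ - 1) • ((u : E3) + frameRes A e u) := by
  have hn : ‖p u‖ ≠ 0 := norm_ne_zero_iff.2 (hp u)
  have h : A.symm (p u) = ‖p u‖ • A.symm (e u) := by
    rw [he, LinearIsometryEquiv.map_smul, smul_smul, mul_inv_cancel₀ hn, one_smul]
  simp only [frameRes]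
  rw [h]
  simp only [sub_smul, one_smul, smul_add, smul_sub]
  abel

/-- `‖A⁻¹ p_u − u‖ ≤ aTot θ α`. [folklore] -/
theorem norm_frameRes_le (A : E3 ≃ₗᵢ[ℝ] E3) {p e : ↥Pat → E3} (he : ∀ u, e u = ‖p u‖⁻¹ • p u) {θ α : ℝ}
    (hrad : ∀ u, 1 ≤ ‖p u‖ ∧ ‖p u‖ ≤ 1 + θ) (h1 : ∀ z ∈ Pat, ‖z‖ = 1) (ha : ∀ u, ‖frameRes A e u‖ ≤ α) (u : ↥Pat) :
    ‖frameRes A p u‖ ≤ aTot θ α := by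
  have hp : ∀ u, p u ≠ 0 := fun u => norm_ne_zero_iff.1 (by linarith [(hrad u).1])
  obtain ⟨h1u, h2u⟩ := hrad u
  have hua : ‖(u : E3) + frameRes A e u‖ ≤ 1 + α := (norm_add_le _ _).trans (by rw [h1 u u.2]; linarith [ha u])
  rw [frameRes_eq_of_unit A he hp u]
  calc _ ≤ ‖frameRes A e u‖ + ‖(‖p u‖ - 1) • ((u : E3) + frameRes A e u)‖ := norm_add_le _ _
    _ = ‖frameRes A e u‖ + (‖p u‖ - 1) * ‖(u : E3) + frameRes A e u‖ := by
        rw [norm_smul, Real.norm_of_nonneg (by linarith)]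
    _ ≤ α + θ * (1 + α) := by
        have := mul_le_mul (by linarith : ‖p u‖ - 1 ≤ θ) hua (norm_nonneg _) (by linarith)
        linarith [ha u]
    _ = aTot θ α := by simp only [aTot]; ring

/-- `‖u × (A⁻¹ p_u − A⁻¹ e_u)‖ ≤ θ·α` — the radial part `(‖p_u‖ − 1)·u` is killed by `u × u = 0`. [folklore] -/
theorem norm_cross_frameRes_sub_le (A : E3 ≃ₗᵢ[ℝ] E3) {p e : ↥Pat → E3} (he : ∀ u, e u = ‖p u‖⁻¹ • p u) {θ α : ℝ}
    (hrad : ∀ u, 1 ≤ ‖p u‖ ∧ ‖p u‖ ≤ 1 + θ) (h1 : ∀ z ∈ Pat, ‖z‖ = 1) (ha : ∀ u, ‖frameRes A e u‖ ≤ α) (u : ↥Pat) :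
    ‖cross (u : E3) (frameRes A p u - frameRes A e u)‖ ≤ θ * α := by
  have hp : ∀ u, p u ≠ 0 := fun u => norm_ne_zero_iff.1 (by linarith [(hrad u).1])
  obtain ⟨h1u, h2u⟩ := hrad u
  have e1 : frameRes A p u - frameRes A e u = (‖p u‖ - 1) • ((u : E3) + frameRes A e u) := by
    rw [frameRes_eq_of_unit A he hp u]; abel
  rw [e1, cross_smul_right, cross_add_right, cross_self, zero_add, norm_smul, Real.norm_of_nonneg (by linarith)]
  calc (‖p u‖ - 1) * ‖cross (u : E3) (frameRes A e u)‖ ≤ θ * (‖(u : E3)‖ * ‖frameRes A e u‖) :=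
        mul_le_mul (by linarith) (norm_cross_le _ _) (norm_nonneg _) (by linarith)
    _ ≤ θ * α := by rw [h1 u u.2, one_mul]; exact mul_le_mul_of_nonneg_left (ha u) (by linarith)

/-- `‖lsRot (A⁻¹ p − id) − lsRot (A⁻¹ e − id)‖ ≤ (3/2)·θ·α`. [folklore] -/
theorem norm_lsRot_frameRes_sub_le (hcard : Pat.card = 12) (A : E3 ≃ₗᵢ[ℝ] E3) {p e : ↥Pat → E3}
    (he : ∀ u, e u = ‖p u‖⁻¹ • p u) {θ α : ℝ} (hrad : ∀ u, 1 ≤ ‖p u‖ ∧ ‖p u‖ ≤ 1 + θ) (h1 : ∀ z ∈ Pat, ‖z‖ = 1)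
    (ha : ∀ u, ‖frameRes A e u‖ ≤ α) :
    ‖lsRot Pat (frameRes A p) - lsRot Pat (frameRes A e)‖ ≤ 3 / 2 * (θ * α) :=
  norm_lsRot_sub_le hcard fun u => norm_cross_frameRes_sub_le A he hrad h1 ha u

/-- **Shell comparison**: `⟪n, derot(A⁻¹p − id)_u⟫ ≤ ⟪n, derot(A⁻¹e − id)_u⟫ + θ(1+α) + (3/2)θα` for `‖n‖ ≤ 1`. [folklore] -/
theorem inner_derot_frameRes_le (hcard : Pat.card = 12) (A : E3 ≃ₗᵢ[ℝ] E3) {p e : ↥Pat → E3}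
    (he : ∀ u, e u = ‖p u‖⁻¹ • p u) {θ α : ℝ} (hrad : ∀ u, 1 ≤ ‖p u‖ ∧ ‖p u‖ ≤ 1 + θ) (h1 : ∀ z ∈ Pat, ‖z‖ = 1)
    (ha : ∀ u, ‖frameRes A e u‖ ≤ α) {n : E3} (hn : ‖n‖ ≤ 1) (u : ↥Pat) :
    ⟪n, derot Pat (frameRes A p) u⟫ ≤ ⟪n, derot Pat (frameRes A e) u⟫ + (θ * (1 + α) + 3 / 2 * (θ * α)) := by
  have hp : ∀ u, p u ≠ 0 := fun u => norm_ne_zero_iff.1 (by linarith [(hrad u).1])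
  have hL := norm_lsRot_frameRes_sub_le hcard A he hrad h1 ha
  obtain ⟨h1u, h2u⟩ := hrad u
  have hua : ‖(u : E3) + frameRes A e u‖ ≤ 1 + α := (norm_add_le _ _).trans (by rw [h1 u u.2]; linarith [ha u])
  have hsplit : derot Pat (frameRes A p) u = derot Pat (frameRes A e) u +
      ((‖p u‖ - 1) • ((u : E3) + frameRes A e u) - cross (lsRot Pat (frameRes A p) - lsRot Pat (frameRes A e)) u) := by
    simp only [derot]
    rw [frameRes_eq_of_unit A he hp u, cross_sub_left]
    abel
  have hjunk : ‖(‖p u‖ - 1) • ((u : E3) + frameRes A e u) - cross (lsRot Pat (frameRes A p) - lsRot Pat (frameRes A e)) u‖ ≤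
      θ * (1 + α) + 3 / 2 * (θ * α) := by
    refine (norm_sub_le _ _).trans (add_le_add ?_ ?_)
    · rw [norm_smul, Real.norm_of_nonneg (by linarith)]
      exact mul_le_mul (by linarith) hua (norm_nonneg _) (by linarith)
    · calc _ ≤ ‖lsRot Pat (frameRes A p) - lsRot Pat (frameRes A e)‖ * ‖(u : E3)‖ := norm_cross_le _ _
        _ ≤ _ := by rw [h1 u u.2, mul_one]; exact hL
  rw [hsplit, inner_add_right]
  have : ⟪n, (‖p u‖ - 1) • ((u : E3) + frameRes A e u) - cross (lsRot Pat (frameRes A p) - lsRot Pat (frameRes A e)) u⟫ ≤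
      θ * (1 + α) + 3 / 2 * (θ * α) :=
    calc _ ≤ ‖n‖ * ‖(‖p u‖ - 1) • ((u : E3) + frameRes A e u) - cross (lsRot Pat (frameRes A p) - lsRot Pat (frameRes A e)) u‖ :=
          real_inner_le_norm _ _
      _ ≤ 1 * (θ * (1 + α) + 3 / 2 * (θ * α)) := mul_le_mul hn hjunk (norm_nonneg _) (by norm_num)
      _ = _ := one_mul _
  linarith

/-- **Contact comparison**: the same for differences along a pattern contact `‖u − w‖ = 1`, with `2θ(1+α) + (3/2)θα`. [folklore] -/
theorem inner_derot_frameRes_sub_le (hcard : Pat.card = 12) (A : E3 ≃ₗᵢ[ℝ] E3) {p e : ↥Pat → E3}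
    (he : ∀ u, e u = ‖p u‖⁻¹ • p u) {θ α : ℝ} (hrad : ∀ u, 1 ≤ ‖p u‖ ∧ ‖p u‖ ≤ 1 + θ) (h1 : ∀ z ∈ Pat, ‖z‖ = 1)
    (ha : ∀ u, ‖frameRes A e u‖ ≤ α) {n : E3} (hn : ‖n‖ ≤ 1) {u w : ↥Pat} (huw : ‖(u : E3) - w‖ = 1) :
    ⟪n, derot Pat (frameRes A p) u - derot Pat (frameRes A p) w⟫ ≤
      ⟪n, derot Pat (frameRes A e) u - derot Pat (frameRes A e) w⟫ + (2 * (θ * (1 + α)) + 3 / 2 * (θ * α)) := by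
  have hp : ∀ u, p u ≠ 0 := fun u => norm_ne_zero_iff.1 (by linarith [(hrad u).1])
  have hL := norm_lsRot_frameRes_sub_le hcard A he hrad h1 ha
  have hs : ∀ v : ↥Pat, ‖(‖p v‖ - 1) • ((v : E3) + frameRes A e v)‖ ≤ θ * (1 + α) := by
    intro v
    obtain ⟨h1v, h2v⟩ := hrad v
    have hva : ‖(v : E3) + frameRes A e v‖ ≤ 1 + α := (norm_add_le _ _).trans (by rw [h1 v v.2]; linarith [ha v])
    rw [norm_smul, Real.norm_of_nonneg (by linarith)]
    exact mul_le_mul (by linarith) hva (norm_nonneg _) (by linarith)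
  have hsplit : derot Pat (frameRes A p) u - derot Pat (frameRes A p) w =
      (derot Pat (frameRes A e) u - derot Pat (frameRes A e) w) +
      (((‖p u‖ - 1) • ((u : E3) + frameRes A e u) - (‖p w‖ - 1) • ((w : E3) + frameRes A e w)) -
        cross (lsRot Pat (frameRes A p) - lsRot Pat (frameRes A e)) ((u : E3) - w)) := by
    simp only [derot, cross_sub_right, cross_sub_left, frameRes_eq_of_unit A he hp u, frameRes_eq_of_unit A he hp w]
    abel
  have hjunk : ‖((‖p u‖ - 1) • ((u : E3) + frameRes A e u) - (‖p w‖ - 1) • ((w : E3) + frameRes A e w)) -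
      cross (lsRot Pat (frameRes A p) - lsRot Pat (frameRes A e)) ((u : E3) - w)‖ ≤ 2 * (θ * (1 + α)) + 3 / 2 * (θ * α) := by
    refine (norm_sub_le _ _).trans (add_le_add (((norm_sub_le _ _).trans (add_le_add (hs u) (hs w))).trans (by linarith)) ?_)
    calc _ ≤ ‖lsRot Pat (frameRes A p) - lsRot Pat (frameRes A e)‖ * ‖(u : E3) - w‖ := norm_cross_le _ _
      _ ≤ _ := by rw [huw, mul_one]; exact hL
  rw [hsplit, inner_add_right]
  have : ⟪n, ((‖p u‖ - 1) • ((u : E3) + frameRes A e u) - (‖p w‖ - 1) • ((w : E3) + frameRes A e w)) -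
      cross (lsRot Pat (frameRes A p) - lsRot Pat (frameRes A e)) ((u : E3) - w)⟫ ≤ 2 * (θ * (1 + α)) + 3 / 2 * (θ * α) :=
    calc _ ≤ ‖n‖ * ‖((‖p u‖ - 1) • ((u : E3) + frameRes A e u) - (‖p w‖ - 1) • ((w : E3) + frameRes A e w)) -
          cross (lsRot Pat (frameRes A p) - lsRot Pat (frameRes A e)) ((u : E3) - w)‖ := real_inner_le_norm _ _
      _ ≤ 1 * (2 * (θ * (1 + α)) + 3 / 2 * (θ * α)) := mul_le_mul hn hjunk (norm_nonneg _) (by norm_num)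
      _ = _ := one_mul _
  linarith

end Sphere

end Summit.AtomisticToContinuum.Crystallization.Theorems.FrustratedLawDichotomyTwoShellRigidityLsLedger
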